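import Mathlib
import HarnessLib
import Summits.Ventures.LatticeQCDFlow.Scoring.RegenerativeEstimator

/-!
# The regenerative estimator, sharpened: using the concentration of the total tour length
# `Σ N_i ≈ R/ε` as well, `P(|Σ Y_i / Σ N_i − π(f)| ≥ s) ≤ (4/R) · ((2 − ε)(2C)²/s² + (1 − ε))`

HONEST FRAMING: exact (Metropolis-corrected) sampling algorithms for lattice gauge theory;
figures of merit are autocorrelation/cost numbers at stated couplings and volumes; no
continuum-physics claim.

Venture `LatticeQCDFlow` (cell pub-lqcd), topic `Scoring`; FANOUT row 8 (`s0-cpn-nemc`, GEN-16).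
NEW WORK of the cell, not a published result; no definition is introduced.  Notation of
`Scoring/RegenerativeEstimator.lean`.  That file bounded the estimator error by `|Σ Z_i| / R` using
only `N_i ≥ 1`, which costs a factor `1/ε²`.  Here the tour lengths are treated like the tour sums:
`N_1, N_2, …` have mean `1/ε`, second moment `(2 − ε)/ε²`, and are pairwise uncorrelated (cross
moments factorise, `Scoring/RegenerativeTourCovariance.lean` with `h = 1`), so
`E[(Σ_{i=1}^R (N_i − 1/ε))²] = R (1 − ε)/ε²` and `Σ N_i ≥ R/(2ε)` except with probability
`≤ 4(1 − ε)/R`; on that event the error is `≤ 2ε |Σ Z_i| / R`.  Two Chebyshev bounds and a union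
bound give the stated certificate, in which `ε` enters only through `2 − ε` and `1 − ε`.  Printed
counterpart NAMED ONLY: the regenerative method (Mykland–Tierney–Yu 1995; Hobert–Jones–Presnell–
Rosenthal 2002) — here a finite-`R`, CLT-free certificate; nothing is cited as a fact.

## Content (`e = ε.toReal`; `0 < ε < 1`; any initial law; `|f| ≤ C` measurable; `R ≥ 1`, `s > 0`)

* **`splitChain_tourLength_moments`**, **`splitChain_tourLength_uncorrelated`** — `E[N_{i+1}] = 1/e`,
  `E[N_{i+1}²] = (2 − e)/e²`; `E[(N_{i+1} − 1/e)(N_{i'+1} − 1/e)] = 0` for `i ≠ i'`, `= (1 − e)/e²` for `i = i'`;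
* **`regenerative_estimator_confidence_sharp`** — THE CERTIFICATE:
  `P(s ≤ |Σ_{i=1}^R Y_i / Σ_{i=1}^R N_i − π(f)|) ≤ 4 ((2 − e)(2C)²/s² + (1 − e)) / R`.

NOT CLAIMED: optimal constants; a variance-sensitive radius; any `ε` of a concrete sampler.
-/

noncomputable section

namespace Summit.Ventures.LatticeQCDFlow.Scoring

open MeasureTheory ProbabilityTheory Filter Finset Preorder Literature.Probability.MarkovChains
open scoped ENNReal

section Sharp

variable {Ω : Type*} [MeasurableSpace Ω]
  {κ : Kernel Ω Ω} [IsMarkovKernel κ] {ν : Measure Ω} [IsProbabilityMeasure ν] {ε : ℝ≥0∞}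
  {hmin : ∀ x {B : Set Ω}, MeasurableSet B → ε * ν B ≤ κ x B}
  (κs : Kernel (Ω × Bool) (Ω × Bool)) [IsMarkovKernel κs]
  (μs : Measure (Ω × Bool)) [IsProbabilityMeasure μs]

/-- **TOUR LENGTHS: `E[N_{i+1}] = 1/e`, `E[N_{i+1}²] = (2 − e)/e²`** (both integrable), from any
start — tour `i + 1` is distributed as tour `0` of the fresh chain. -/
theorem splitChain_tourLength_moments (hε0 : 0 < ε) (hε : ε < 1)
    (hκs : ∀ p, κs p = (ε • ν).map (fun y : Ω => (y, true))
      + ((1 - ε) • Doeblin.residualKernel κ ν ε hmin p.1).map (fun y : Ω => (y, false)))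
    (i : ℕ) :
    Integrable (fun x : ℕ → Ω × Bool => ∑' u, (if (∑ s ∈ Finset.range u,
        (if (x (s + 1)).2 then (1 : ℕ) else 0)) = i + 1 then (1 : ℝ) else 0))
      (Kernel.trajMeasure (X := fun _ : ℕ => Ω × Bool) μs
        (fun n : ℕ => κs.comap (fun h : (i : ↥(Finset.Iic n)) → Ω × Bool =>
          h ⟨n, Finset.mem_Iic.2 le_rfl⟩) (measurable_pi_apply _)))
    ∧ Integrable (fun x : ℕ → Ω × Bool => (∑' u, (if (∑ s ∈ Finset.range u,
        (if (x (s + 1)).2 then (1 : ℕ) else 0)) = i + 1 then (1 : ℝ) else 0)) ^ 2)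
      (Kernel.trajMeasure (X := fun _ : ℕ => Ω × Bool) μs
        (fun n : ℕ => κs.comap (fun h : (i : ↥(Finset.Iic n)) → Ω × Bool =>
          h ⟨n, Finset.mem_Iic.2 le_rfl⟩) (measurable_pi_apply _)))
    ∧ ∫ x, ∑' u, (if (∑ s ∈ Finset.range u, (if (x (s + 1)).2 then (1 : ℕ) else 0)) = i + 1
        then (1 : ℝ) else 0)
        ∂(Kernel.trajMeasure (X := fun _ : ℕ => Ω × Bool) μs
          (fun n : ℕ => κs.comap (fun h : (i : ↥(Finset.Iic n)) → Ω × Bool =>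
            h ⟨n, Finset.mem_Iic.2 le_rfl⟩) (measurable_pi_apply _))) = 1 / ε.toReal
    ∧ ∫ x, (∑' u, (if (∑ s ∈ Finset.range u, (if (x (s + 1)).2 then (1 : ℕ) else 0)) = i + 1
        then (1 : ℝ) else 0)) ^ 2
        ∂(Kernel.trajMeasure (X := fun _ : ℕ => Ω × Bool) μs
          (fun n : ℕ => κs.comap (fun h : (i : ↥(Finset.Iic n)) → Ω × Bool =>
            h ⟨n, Finset.mem_Iic.2 le_rfl⟩) (measurable_pi_apply _)))
      = (2 - ε.toReal) / ε.toReal ^ 2 := by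
  haveI hνt : IsProbabilityMeasure (ν.map (fun y : Ω => (y, true))) :=
    Measure.isProbabilityMeasure_map (measurable_tagCoin true).aemeasurable
  obtain ⟨hN0I, hN0E⟩ := splitChain_integral_tourLength_zero κs (ν.map (fun y : Ω => (y, true)))
    (κ := κ) (ν := ν) (hmin := hmin) hε0 hε hκs
  obtain ⟨hN0sqI, hN0sqE⟩ := splitChain_integral_sq_tourLength_zero κs (ν.map (fun y : Ω => (y, true)))
    (κ := κ) (ν := ν) (hmin := hmin) hε0 hε hκs
  have hψ : Measurable fun _pq : (Ω × Bool) × (Ω × Bool) => (1 : ℝ) := measurable_const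
  -- bridge `∑' 1{K_u = i} * 1 = ∑' 1{K_u = i}`
  have hbr : ∀ (y : ℕ → Ω × Bool) (k : ℕ), (∑' u, (if (∑ s ∈ Finset.range u,
      (if (y (s + 1)).2 then (1 : ℕ) else 0)) = k then (1 : ℝ) else 0) * (1 : ℝ))
      = ∑' u, (if (∑ s ∈ Finset.range u, (if (y (s + 1)).2 then (1 : ℕ) else 0)) = k
        then (1 : ℝ) else 0) := fun y k => tsum_congr fun u => mul_one _
  have hN0I' : Integrable (fun y : ℕ → Ω × Bool => (fun a _ => a) (∑' u, (if (∑ s ∈ Finset.range u,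
      (if (y (s + 1)).2 then (1 : ℕ) else 0)) = 0 then (1 : ℝ) else 0) * (1 : ℝ))
      (∑' u, (if (∑ s ∈ Finset.range u, (if (y (s + 1)).2 then (1 : ℕ) else 0)) = 0
        then (1 : ℝ) else 0) * (1 : ℝ)))
      (Kernel.trajMeasure (X := fun _ : ℕ => Ω × Bool) (ν.map (fun y : Ω => (y, true)))
        (fun n : ℕ => κs.comap (fun h : (i : ↥(Finset.Iic n)) → Ω × Bool =>
          h ⟨n, Finset.mem_Iic.2 le_rfl⟩) (measurable_pi_apply _))) :=
    hN0I.congr (ae_of_all _ fun y => by simp only [hbr])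
  have hN0sqI' : Integrable (fun y : ℕ → Ω × Bool => (fun a _ => a ^ 2) (∑' u, (if (∑ s ∈ Finset.range u,
      (if (y (s + 1)).2 then (1 : ℕ) else 0)) = 0 then (1 : ℝ) else 0) * (1 : ℝ))
      (∑' u, (if (∑ s ∈ Finset.range u, (if (y (s + 1)).2 then (1 : ℕ) else 0)) = 0
        then (1 : ℝ) else 0) * (1 : ℝ)))
      (Kernel.trajMeasure (X := fun _ : ℕ => Ω × Bool) (ν.map (fun y : Ω => (y, true)))
        (fun n : ℕ => κs.comap (fun h : (i : ↥(Finset.Iic n)) → Ω × Bool =>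
          h ⟨n, Finset.mem_Iic.2 le_rfl⟩) (measurable_pi_apply _))) :=
    hN0sqI.congr (ae_of_all _ fun y => by simp only [hbr])
  have h1I := splitChain_tourFunctional_integrable κs μs (κ := κ) (ν := ν) (hmin := hmin) hε hκs i
    (ψ₁ := fun _ _ => (1 : ℝ)) (ψ₂ := fun _ _ => (1 : ℝ)) hψ hψ (Λ := fun a _ => a) rfl
    measurable_fst hN0I'
  have h1E := splitChain_tour_identically_distributed κs μs (κ := κ) (ν := ν) (hmin := hmin) hε0 hε
    hκs i (ψ₁ := fun _ _ => (1 : ℝ)) (ψ₂ := fun _ _ => (1 : ℝ)) hψ hψ (Λ := fun a _ => a) rfl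
    measurable_fst hN0I'
  have h2I := splitChain_tourFunctional_integrable κs μs (κ := κ) (ν := ν) (hmin := hmin) hε hκs i
    (ψ₁ := fun _ _ => (1 : ℝ)) (ψ₂ := fun _ _ => (1 : ℝ)) hψ hψ (Λ := fun a _ => a ^ 2)
    (by norm_num) ((measurable_fst (α := ℝ) (β := ℝ)).pow_const 2) hN0sqI'
  have h2E := splitChain_tour_identically_distributed κs μs (κ := κ) (ν := ν) (hmin := hmin) hε0 hε
    hκs i (ψ₁ := fun _ _ => (1 : ℝ)) (ψ₂ := fun _ _ => (1 : ℝ)) hψ hψ (Λ := fun a _ => a ^ 2)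
    (by norm_num) ((measurable_fst (α := ℝ) (β := ℝ)).pow_const 2) hN0sqI'
  simp only [hbr] at h1I h1E h2I h2E
  exact ⟨h1I, h2I, h1E.trans hN0E, h2E.trans hN0sqE⟩

/-- **TOUR LENGTHS ARE UNCORRELATED**: for `i ≠ i'`, `(N_{i+1} − 1/e)(N_{i'+1} − 1/e)` is
integrable with integral `0`; for `i = i'` its integral is `(1 − e)/e²`. -/
theorem splitChain_tourLength_uncorrelated (hε0 : 0 < ε) (hε : ε < 1)
    (hκs : ∀ p, κs p = (ε • ν).map (fun y : Ω => (y, true))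
      + ((1 - ε) • Doeblin.residualKernel κ ν ε hmin p.1).map (fun y : Ω => (y, false)))
    (i i' : ℕ) :
    Integrable (fun x : ℕ → Ω × Bool =>
        ((∑' u, (if (∑ s ∈ Finset.range u, (if (x (s + 1)).2 then (1 : ℕ) else 0)) = i + 1
          then (1 : ℝ) else 0)) - 1 / ε.toReal)
        * ((∑' u, (if (∑ s ∈ Finset.range u, (if (x (s + 1)).2 then (1 : ℕ) else 0)) = i' + 1
          then (1 : ℝ) else 0)) - 1 / ε.toReal))
      (Kernel.trajMeasure (X := fun _ : ℕ => Ω × Bool) μs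
        (fun n : ℕ => κs.comap (fun h : (i : ↥(Finset.Iic n)) → Ω × Bool =>
          h ⟨n, Finset.mem_Iic.2 le_rfl⟩) (measurable_pi_apply _)))
    ∧ (i ≠ i' → ∫ x, ((∑' u, (if (∑ s ∈ Finset.range u, (if (x (s + 1)).2 then (1 : ℕ) else 0))
          = i + 1 then (1 : ℝ) else 0)) - 1 / ε.toReal)
        * ((∑' u, (if (∑ s ∈ Finset.range u, (if (x (s + 1)).2 then (1 : ℕ) else 0)) = i' + 1
          then (1 : ℝ) else 0)) - 1 / ε.toReal)
        ∂(Kernel.trajMeasure (X := fun _ : ℕ => Ω × Bool) μs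
          (fun n : ℕ => κs.comap (fun h : (i : ↥(Finset.Iic n)) → Ω × Bool =>
            h ⟨n, Finset.mem_Iic.2 le_rfl⟩) (measurable_pi_apply _))) = 0)
    ∧ (i = i' → ∫ x, ((∑' u, (if (∑ s ∈ Finset.range u, (if (x (s + 1)).2 then (1 : ℕ) else 0))
          = i + 1 then (1 : ℝ) else 0)) - 1 / ε.toReal)
        * ((∑' u, (if (∑ s ∈ Finset.range u, (if (x (s + 1)).2 then (1 : ℕ) else 0)) = i' + 1
          then (1 : ℝ) else 0)) - 1 / ε.toReal)
        ∂(Kernel.trajMeasure (X := fun _ : ℕ => Ω × Bool) μs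
          (fun n : ℕ => κs.comap (fun h : (i : ↥(Finset.Iic n)) → Ω × Bool =>
            h ⟨n, Finset.mem_Iic.2 le_rfl⟩) (measurable_pi_apply _)))
        ≤ (1 - ε.toReal) / ε.toReal ^ 2) := by
  haveI hνt : IsProbabilityMeasure (ν.map (fun y : Ω => (y, true))) :=
    Measure.isProbabilityMeasure_map (measurable_tagCoin true).aemeasurable
  set P := Kernel.trajMeasure (X := fun _ : ℕ => Ω × Bool) μs
      (fun n : ℕ => κs.comap (fun h : (i : ↥(Finset.Iic n)) → Ω × Bool =>
        h ⟨n, Finset.mem_Iic.2 le_rfl⟩) (measurable_pi_apply _)) with hP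
  set m : ℝ := 1 / ε.toReal with hm
  have he0 : 0 < ε.toReal := ENNReal.toReal_pos hε0.ne' (ne_top_of_lt hε)
  have hbr : ∀ (y : ℕ → Ω × Bool) (k : ℕ), (∑' u, (if (∑ s ∈ Finset.range u,
      (if (y (s + 1)).2 then (1 : ℕ) else 0)) = k then (1 : ℝ) else 0) * (1 : ℝ))
      = ∑' u, (if (∑ s ∈ Finset.range u, (if (y (s + 1)).2 then (1 : ℕ) else 0)) = k
        then (1 : ℝ) else 0) := fun y k => tsum_congr fun u => mul_one _
  -- moments of each tour length
  have hMi := splitChain_tourLength_moments κs μs (κ := κ) (ν := ν) (hmin := hmin) hε0 hε hκs i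
  have hMi' := splitChain_tourLength_moments κs μs (κ := κ) (ν := ν) (hmin := hmin) hε0 hε hκs i'
  rw [← hP] at hMi hMi'
  obtain ⟨hNiI, hNisqI, hNiE, hNisqE⟩ := hMi
  obtain ⟨hNi'I, hNi'sqI, hNi'E, hNi'sqE⟩ := hMi'
  -- `E_fresh[N_0] = 1/e`
  have hN0E := (splitChain_integral_tourLength_zero κs (ν.map (fun y : Ω => (y, true)))
    (κ := κ) (ν := ν) (hmin := hmin) hε0 hε hκs).2
  -- the product `N_{i+1} N_{i'+1}`: integrable, and `= m · m` in expectation when `i ≠ i'`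
  have hprod : ∀ k k' : ℕ, k < k' → Integrable (fun x : ℕ → Ω × Bool =>
      (∑' u, (if (∑ s ∈ Finset.range u, (if (x (s + 1)).2 then (1 : ℕ) else 0)) = k + 1
        then (1 : ℝ) else 0))
      * (∑' u, (if (∑ s ∈ Finset.range u, (if (x (s + 1)).2 then (1 : ℕ) else 0)) = k' + 1
        then (1 : ℝ) else 0))) P
      ∧ ∫ x, (∑' u, (if (∑ s ∈ Finset.range u, (if (x (s + 1)).2 then (1 : ℕ) else 0)) = k + 1
        then (1 : ℝ) else 0))
      * (∑' u, (if (∑ s ∈ Finset.range u, (if (x (s + 1)).2 then (1 : ℕ) else 0)) = k' + 1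
        then (1 : ℝ) else 0)) ∂P = m * m := by
    intro k k' hkk'
    obtain ⟨hI, hE⟩ := splitChain_tour_crossMoment κs μs (κ := κ) (ν := ν) (hmin := hmin) hε0 hε
      hκs (h₁ := fun _ => (1 : ℝ)) (h₂ := fun _ => (1 : ℝ)) measurable_const measurable_const
      (C₁ := 1) (C₂ := 1) (fun _ => by simp) (fun _ => by simp) (i := k + 1) (j := k') (by omega)
    rw [← hP] at hI hE
    simp only [hbr] at hI hE
    have hk := (splitChain_tourLength_moments κs μs (κ := κ) (ν := ν) (hmin := hmin) hε0 hε hκs k).2.2.1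
    rw [← hP] at hk
    refine ⟨hI, ?_⟩
    rw [hE, hk, hN0E]
  -- expand `(A − m)(B − m)` for integrable `A`, `B`, `A·B`
  have key : ∀ (A B : (ℕ → Ω × Bool) → ℝ), Integrable A P → Integrable B P →
      Integrable (fun x => A x * B x) P → ∀ (vAB vA vB : ℝ), ∫ x, A x * B x ∂P = vAB →
      ∫ x, A x ∂P = vA → ∫ x, B x ∂P = vB →
      Integrable (fun x => (A x - m) * (B x - m)) P
        ∧ ∫ x, (A x - m) * (B x - m) ∂P = vAB - m * vA - m * vB + m * m := by
    intro A B hA hB hAB vAB vA vB hvAB hvA hvB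
    have h1 : Integrable (fun x => A x * B x - m * A x) P := hAB.sub (hA.const_mul m)
    have h2 : Integrable (fun x => A x * B x - m * A x - m * B x) P := h1.sub (hB.const_mul m)
    have h3 : Integrable (fun x => A x * B x - m * A x - m * B x + m * m) P :=
      h2.add (integrable_const _)
    refine ⟨h3.congr (ae_of_all _ fun x => by ring), ?_⟩
    calc ∫ x, (A x - m) * (B x - m) ∂P = ∫ x, (A x * B x - m * A x - m * B x + m * m) ∂P :=
          integral_congr_ae (ae_of_all _ fun x => by ring)
      _ = vAB - m * vA - m * vB + m * m := by
          rw [integral_add h2 (integrable_const _), integral_sub h1 (hB.const_mul m),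
            integral_sub hAB (hA.const_mul m), integral_const_mul, integral_const_mul,
            integral_const, probReal_univ, one_smul, hvAB, hvA, hvB]
  rcases lt_trichotomy i i' with h | h | h
  · obtain ⟨hI, hE⟩ := hprod i i' h
    obtain ⟨hInt, hval⟩ := key _ _ hNiI hNi'I hI _ _ _ hE hNiE hNi'E
    refine ⟨hInt, fun _ => ?_, fun heq => absurd heq (by omega)⟩
    rw [hval, hm]
    ring
  · subst h
    have hsqI' : Integrable (fun x : ℕ → Ω × Bool =>
        (∑' u, (if (∑ s ∈ Finset.range u, (if (x (s + 1)).2 then (1 : ℕ) else 0)) = i + 1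
          then (1 : ℝ) else 0))
        * (∑' u, (if (∑ s ∈ Finset.range u, (if (x (s + 1)).2 then (1 : ℕ) else 0)) = i + 1
          then (1 : ℝ) else 0))) P := hNisqI.congr (ae_of_all _ fun x => by simp only [sq])
    have hsqE' : ∫ x, (∑' u, (if (∑ s ∈ Finset.range u, (if (x (s + 1)).2 then (1 : ℕ) else 0))
          = i + 1 then (1 : ℝ) else 0))
        * (∑' u, (if (∑ s ∈ Finset.range u, (if (x (s + 1)).2 then (1 : ℕ) else 0)) = i + 1
          then (1 : ℝ) else 0)) ∂P = (2 - ε.toReal) / ε.toReal ^ 2 := by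
      rw [← hNisqE]
      exact integral_congr_ae (ae_of_all _ fun x => by simp only [sq])
    obtain ⟨hInt, hval⟩ := key _ _ hNiI hNiI hsqI' _ _ _ hsqE' hNiE hNiE
    refine ⟨hInt, fun hne => absurd rfl hne, fun _ => ?_⟩
    rw [hval, hm]
    have : (2 - ε.toReal) / ε.toReal ^ 2 - 1 / ε.toReal * (1 / ε.toReal)
        - 1 / ε.toReal * (1 / ε.toReal) + 1 / ε.toReal * (1 / ε.toReal)
        = (1 - ε.toReal) / ε.toReal ^ 2 := by
      field_simp
      ring
    rw [this]
  · obtain ⟨hI, hE⟩ := hprod i' i h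
    have hI' : Integrable (fun x : ℕ → Ω × Bool =>
        (∑' u, (if (∑ s ∈ Finset.range u, (if (x (s + 1)).2 then (1 : ℕ) else 0)) = i + 1
          then (1 : ℝ) else 0))
        * (∑' u, (if (∑ s ∈ Finset.range u, (if (x (s + 1)).2 then (1 : ℕ) else 0)) = i' + 1
          then (1 : ℝ) else 0))) P := hI.congr (ae_of_all _ fun x => mul_comm _ _)
    have hE' : ∫ x, (∑' u, (if (∑ s ∈ Finset.range u, (if (x (s + 1)).2 then (1 : ℕ) else 0))
          = i + 1 then (1 : ℝ) else 0))
        * (∑' u, (if (∑ s ∈ Finset.range u, (if (x (s + 1)).2 then (1 : ℕ) else 0)) = i' + 1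
          then (1 : ℝ) else 0)) ∂P = m * m :=
      (integral_congr_ae (ae_of_all _ fun x => mul_comm _ _)).trans hE
    obtain ⟨hInt, hval⟩ := key _ _ hNiI hNi'I hI' _ _ _ hE' hNiE hNi'E
    refine ⟨hInt, fun _ => ?_, fun heq => absurd heq (by omega)⟩
    rw [hval, hm]
    ring

/-- **THE REGENERATIVE ESTIMATOR'S CLT-FREE ERROR BAR, SHARPENED.**  `π` invariant,
`κ(x, ·) ≥ ε ν` with `0 < ε < 1`, `|f| ≤ C` measurable, any initial law, `R ≥ 1` tours, `s > 0`:
`P(s ≤ |Σ_{i=1}^R Y_i / Σ_{i=1}^R N_i − π(f)|) ≤ 4 ((2 − e)(2C)²/s² + (1 − e)) / R`. -/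
theorem regenerative_estimator_confidence_sharp {π : Measure Ω} [IsProbabilityMeasure π]
    (hπ : Kernel.Invariant κ π) (hε0 : 0 < ε) (hε : ε < 1)
    (hκs : ∀ p, κs p = (ε • ν).map (fun y : Ω => (y, true))
      + ((1 - ε) • Doeblin.residualKernel κ ν ε hmin p.1).map (fun y : Ω => (y, false)))
    {f : Ω → ℝ} (hf : Measurable f) {C : ℝ} (hC : ∀ x, |f x| ≤ C) {R : ℕ} (hR : 0 < R)
    {s : ℝ} (hs : 0 < s) :
    (Kernel.trajMeasure (X := fun _ : ℕ => Ω × Bool) μs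
        (fun n : ℕ => κs.comap (fun h : (i : ↥(Finset.Iic n)) → Ω × Bool =>
          h ⟨n, Finset.mem_Iic.2 le_rfl⟩) (measurable_pi_apply _))).real
      {x | s ≤ |(∑ i ∈ Finset.range R, ∑' u, (if (∑ s ∈ Finset.range u,
            (if (x (s + 1)).2 then (1 : ℕ) else 0)) = i + 1 then (1 : ℝ) else 0) * f (x u).1)
          / (∑ i ∈ Finset.range R, ∑' u, (if (∑ s ∈ Finset.range u,
            (if (x (s + 1)).2 then (1 : ℕ) else 0)) = i + 1 then (1 : ℝ) else 0))
          - ∫ z, f z ∂π|}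
      ≤ 4 * ((2 - ε.toReal) * (2 * C) ^ 2 / s ^ 2 + (1 - ε.toReal)) / R := by
  set P := Kernel.trajMeasure (X := fun _ : ℕ => Ω × Bool) μs
      (fun n : ℕ => κs.comap (fun h : (i : ↥(Finset.Iic n)) → Ω × Bool =>
        h ⟨n, Finset.mem_Iic.2 le_rfl⟩) (measurable_pi_apply _)) with hP
  set c := ∫ z, f z ∂π with hc
  have he0 : 0 < ε.toReal := ENNReal.toReal_pos hε0.ne' (ne_top_of_lt hε)
  have hR0 : (0 : ℝ) < R := Nat.cast_pos.2 hR
  -- second moments of `Σ Z_{i+1}` and of `Σ (N_{i+1} − 1/e)`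
  have hU := fun i i' => splitChain_centredTourSum_uncorrelated κs μs (κ := κ) (ν := ν) (hmin := hmin)
    hπ hε0 hε hκs hf hC i i'
  obtain ⟨hZsqI, hZsq⟩ := integral_sq_sum_le_of_uncorrelated P
    (fun i x => ∑' u, (if (∑ s ∈ Finset.range u, (if (x (s + 1)).2 then (1 : ℕ) else 0)) = i + 1
      then (1 : ℝ) else 0) * (f (x u).1 - c)) R (v := (2 * C) ^ 2 * ((2 - ε.toReal) / ε.toReal ^ 2))
    (fun i _ i' _ => (hU i i').1) (fun i _ i' _ hne => (hU i i').2.1 hne)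
    (fun i _ => (hU i i).2.2 rfl)
  have hV := fun i i' => splitChain_tourLength_uncorrelated κs μs (κ := κ) (ν := ν) (hmin := hmin)
    hε0 hε hκs i i'
  obtain ⟨hNsqI, hNsq⟩ := integral_sq_sum_le_of_uncorrelated P
    (fun i x => (∑' u, (if (∑ s ∈ Finset.range u, (if (x (s + 1)).2 then (1 : ℕ) else 0)) = i + 1
      then (1 : ℝ) else 0)) - 1 / ε.toReal) R (v := (1 - ε.toReal) / ε.toReal ^ 2)
    (fun i _ i' _ => (hV i i').1) (fun i _ i' _ hne => (hV i i').2.1 hne)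
    (fun i _ => (hV i i).2.2 rfl)
  have hψ : Measurable fun pq : (Ω × Bool) × (Ω × Bool) => f pq.1.1 - c :=
    (hf.sub_const c).comp (measurable_fst.comp measurable_fst)
  have hZm : ∀ i, Measurable fun x : ℕ → Ω × Bool => ∑' u, (if (∑ s ∈ Finset.range u,
      (if (x (s + 1)).2 then (1 : ℕ) else 0)) = i + 1 then (1 : ℝ) else 0) * (f (x u).1 - c) :=
    fun i => measurable_tourSum (Ω := Ω) (ψ := fun p _ => f p.1 - c) hψ (i + 1)
  have hNm : ∀ i, Measurable fun x : ℕ → Ω × Bool => (∑' u, (if (∑ s ∈ Finset.range u,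
      (if (x (s + 1)).2 then (1 : ℕ) else 0)) = i + 1 then (1 : ℝ) else 0)) - 1 / ε.toReal :=
    fun i => (Measurable.tsum fun u => measurable_headCountIndicator u (i + 1)).sub_const _
  have hmemZ : MemLp (fun x : ℕ → Ω × Bool => ∑ i ∈ Finset.range R, ∑' u, (if (∑ s ∈ Finset.range u,
      (if (x (s + 1)).2 then (1 : ℕ) else 0)) = i + 1 then (1 : ℝ) else 0) * (f (x u).1 - c)) 2 P :=
    (memLp_two_iff_integrable_sq (Finset.aestronglyMeasurable_fun_sum _ fun i _ =>
      (hZm i).aestronglyMeasurable)).2 hZsqI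
  have hmemN : MemLp (fun x : ℕ → Ω × Bool => ∑ i ∈ Finset.range R, ((∑' u, (if (∑ s ∈ Finset.range u,
      (if (x (s + 1)).2 then (1 : ℕ) else 0)) = i + 1 then (1 : ℝ) else 0)) - 1 / ε.toReal)) 2 P :=
    (memLp_two_iff_integrable_sq (Finset.aestronglyMeasurable_fun_sum _ fun i _ =>
      (hNm i).aestronglyMeasurable)).2 hNsqI
  have haZ : 0 < s * R / (2 * ε.toReal) := by positivity
  have haN : 0 < (R : ℝ) / (2 * ε.toReal) := by positivity
  have hChebZ : P.real {x : ℕ → Ω × Bool | s * R / (2 * ε.toReal) ≤ |∑ i ∈ Finset.range R, ∑' u,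
      (if (∑ s ∈ Finset.range u, (if (x (s + 1)).2 then (1 : ℕ) else 0)) = i + 1
        then (1 : ℝ) else 0) * (f (x u).1 - c)|}
      ≤ (∫ x, (∑ i ∈ Finset.range R, ∑' u, (if (∑ s ∈ Finset.range u,
          (if (x (s + 1)).2 then (1 : ℕ) else 0)) = i + 1 then (1 : ℝ) else 0) * (f (x u).1 - c)) ^ 2 ∂P)
          / (s * R / (2 * ε.toReal)) ^ 2 := by
    simpa only [sub_zero] using measureReal_abs_sub_ge_le hmemZ 0 haZ
  have hChebN : P.real {x : ℕ → Ω × Bool | (R : ℝ) / (2 * ε.toReal) ≤ |∑ i ∈ Finset.range R,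
      ((∑' u, (if (∑ s ∈ Finset.range u, (if (x (s + 1)).2 then (1 : ℕ) else 0)) = i + 1
        then (1 : ℝ) else 0)) - 1 / ε.toReal)|}
      ≤ (∫ x, (∑ i ∈ Finset.range R, ((∑' u, (if (∑ s ∈ Finset.range u,
          (if (x (s + 1)).2 then (1 : ℕ) else 0)) = i + 1 then (1 : ℝ) else 0)) - 1 / ε.toReal)) ^ 2 ∂P)
          / ((R : ℝ) / (2 * ε.toReal)) ^ 2 := by
    simpa only [sub_zero] using measureReal_abs_sub_ge_le hmemN 0 haN
  -- almost surely: outside both Chebyshev events the estimate is `s`-close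
  have hae := splitChain_ae_tourStart κs μs (κ := κ) (ν := ν) (hmin := hmin) hε0 hε hκs
  rw [← hP] at hae
  have hincl : ∀ᵐ x ∂P, x ∈ {x : ℕ → Ω × Bool | s ≤ |(∑ i ∈ Finset.range R, ∑' u,
        (if (∑ s ∈ Finset.range u, (if (x (s + 1)).2 then (1 : ℕ) else 0)) = i + 1
          then (1 : ℝ) else 0) * f (x u).1)
        / (∑ i ∈ Finset.range R, ∑' u, (if (∑ s ∈ Finset.range u,
          (if (x (s + 1)).2 then (1 : ℕ) else 0)) = i + 1 then (1 : ℝ) else 0)) - c|}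
      → x ∈ {x : ℕ → Ω × Bool | s * R / (2 * ε.toReal) ≤ |∑ i ∈ Finset.range R, ∑' u,
          (if (∑ s ∈ Finset.range u, (if (x (s + 1)).2 then (1 : ℕ) else 0)) = i + 1
            then (1 : ℝ) else 0) * (f (x u).1 - c)|}
        ∪ {x : ℕ → Ω × Bool | (R : ℝ) / (2 * ε.toReal) ≤ |∑ i ∈ Finset.range R,
          ((∑' u, (if (∑ s ∈ Finset.range u, (if (x (s + 1)).2 then (1 : ℕ) else 0)) = i + 1
            then (1 : ℝ) else 0)) - 1 / ε.toReal)|} := by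
    filter_upwards [hae] with x hx hbad
    have hfin : ∀ i : ℕ, (∑' u, (if (∑ s ∈ Finset.range u, (if (x (s + 1)).2 then (1 : ℕ) else 0))
          = i + 1 then (1 : ℝ) else 0) * (f (x u).1 - c))
        = (∑' u, (if (∑ s ∈ Finset.range u, (if (x (s + 1)).2 then (1 : ℕ) else 0)) = i + 1
            then (1 : ℝ) else 0) * f (x u).1)
          - c * (∑' u, (if (∑ s ∈ Finset.range u, (if (x (s + 1)).2 then (1 : ℕ) else 0))
            = i + 1 then (1 : ℝ) else 0)) := by
      intro i
      obtain ⟨t₁, ht₁, hh₁⟩ := hx (i + 1)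
      rw [tourSum_eq_finsetSum (fun p _ => f p.1 - c) x le_rfl ht₁ hh₁,
        tourSum_eq_finsetSum (fun p _ => f p.1) x le_rfl ht₁ hh₁,
        tourLength_eq_finsetSum x le_rfl ht₁ hh₁, Finset.mul_sum, ← Finset.sum_sub_distrib]
      exact Finset.sum_congr rfl fun u _ => by ring
    set SY := ∑ i ∈ Finset.range R, ∑' u, (if (∑ s ∈ Finset.range u,
      (if (x (s + 1)).2 then (1 : ℕ) else 0)) = i + 1 then (1 : ℝ) else 0) * f (x u).1 with hSY
    set SN := ∑ i ∈ Finset.range R, ∑' u, (if (∑ s ∈ Finset.range u,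
      (if (x (s + 1)).2 then (1 : ℕ) else 0)) = i + 1 then (1 : ℝ) else 0) with hSN
    have hSZ : ∑ i ∈ Finset.range R, ∑' u, (if (∑ s ∈ Finset.range u,
        (if (x (s + 1)).2 then (1 : ℕ) else 0)) = i + 1 then (1 : ℝ) else 0) * (f (x u).1 - c)
        = SY - c * SN := by
      rw [Finset.sum_congr rfl fun i _ => hfin i, Finset.sum_sub_distrib, ← Finset.mul_sum]
    have hSM : ∑ i ∈ Finset.range R, ((∑' u, (if (∑ s ∈ Finset.range u,
        (if (x (s + 1)).2 then (1 : ℕ) else 0)) = i + 1 then (1 : ℝ) else 0)) - 1 / ε.toReal)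
        = SN - R / ε.toReal := by
      rw [Finset.sum_sub_distrib, Finset.sum_const, Finset.card_range, nsmul_eq_mul]
      ring
    by_contra hnot
    simp only [Set.mem_union, Set.mem_setOf_eq, not_or, not_le] at hnot
    obtain ⟨hZlt, hNlt⟩ := hnot
    rw [hSZ] at hZlt
    rw [hSM] at hNlt
    have hSNlow : (R : ℝ) / (2 * ε.toReal) < SN := by
      have := neg_lt_of_abs_lt hNlt
      have hRe : (R : ℝ) / ε.toReal = 2 * ((R : ℝ) / (2 * ε.toReal)) := by field_simp
      linarith
    have hkey : s * SN ≤ |SY - c * SN| := by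
      have hSN0 : 0 < SN := haN.trans hSNlow
      have h1 : SY - c * SN = (SY / SN - c) * SN := by field_simp
      rw [h1, abs_mul, abs_of_pos hSN0]
      exact mul_le_mul_of_nonneg_right hbad hSN0.le
    have h2 : s * ((R : ℝ) / (2 * ε.toReal)) < s * SN := mul_lt_mul_of_pos_left hSNlow hs
    have h3 : s * ((R : ℝ) / (2 * ε.toReal)) = s * R / (2 * ε.toReal) := by ring
    linarith
  -- assemble
  calc P.real _ ≤ P.real ({x : ℕ → Ω × Bool | s * R / (2 * ε.toReal) ≤ |∑ i ∈ Finset.range R, ∑' u,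
          (if (∑ s ∈ Finset.range u, (if (x (s + 1)).2 then (1 : ℕ) else 0)) = i + 1
            then (1 : ℝ) else 0) * (f (x u).1 - c)|}
        ∪ {x : ℕ → Ω × Bool | (R : ℝ) / (2 * ε.toReal) ≤ |∑ i ∈ Finset.range R,
          ((∑' u, (if (∑ s ∈ Finset.range u, (if (x (s + 1)).2 then (1 : ℕ) else 0)) = i + 1
            then (1 : ℝ) else 0)) - 1 / ε.toReal)|}) :=
        ENNReal.toReal_mono (measure_ne_top _ _) (measure_mono_ae hincl)
    _ ≤ _ := measureReal_union_le _ _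
    _ ≤ (R * ((2 * C) ^ 2 * ((2 - ε.toReal) / ε.toReal ^ 2))) / (s * R / (2 * ε.toReal)) ^ 2
        + (R * ((1 - ε.toReal) / ε.toReal ^ 2)) / ((R : ℝ) / (2 * ε.toReal)) ^ 2 :=
        add_le_add (hChebZ.trans (div_le_div_of_nonneg_right hZsq (by positivity)))
          (hChebN.trans (div_le_div_of_nonneg_right hNsq (by positivity)))
    _ = 4 * ((2 - ε.toReal) * (2 * C) ^ 2 / s ^ 2 + (1 - ε.toReal)) / R := by
        field_simp
        ring

end Sharp

end Summit.Ventures.LatticeQCDFlow.Scoring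

end
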